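import Literature.MathematicalPhysics.QuantumLattice.LiebMattisSectorPF
import Literature.MathematicalPhysics.QuantumLattice.HeisenbergSectorEnclosureCertificate
import HarnessLib

/-!
# Ventures/CertifiedQuantumChemistry — Rows/HeisenbergSectorCollatzWielandt.lean: the two-sided Collatz–Wielandt
# enclosure of a sector energy of the Heisenberg antiferromagnet from ANY strictly Marshall-positive trial vector

HONEST FRAMING (verbatim): certified bounds for a stated model Hamiltonian in a stated basis; not a
claim about the real molecule beyond that model.

Seat ref/typer (`pub-qchem-typer`, gen 21). THEOREMS ONLY (no `def`, no claim node, no row, no certificate), zero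
compute, standard axioms; scores nothing, moves no `CERTIFIED.md` byte. The CERTIFICATE form of the Perron–Frobenius
identification of `Rows/HeisenbergSpinHalfPerron.lean` §3 (there: an exact positive eigenvector gives the sector
energy exactly; here: an arbitrary positive trial vector gives a two-sided bracket), i.e. the soundness theorem behind
the stdlib deposit `HOME/pub-qchem-typer/h-cw-cert/` (exact rational brackets of `h(L)`, even `L ≤ 20`).

## Statement (`lowestEnergyInSector_mem_Icc_of_marshall_positive_trial`; any spin `n/2`, any finite graph)

`H = J Σ_{{x,y}∈E(G)} 𝐒_x·𝐒_y`, `J > 0`, `G` connected and bipartite in `A`, `Aᶜ`; `W` a nonempty weight sector;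
`w` a vector supported in the sector whose entries obey the Marshall sign rule STRICTLY (`(−1)^{Σ_A σ} w(σ) > 0` real
on every configuration of weight `W`); real numbers `a ≤ b` with, for every configuration `σ` of weight `W`,
`(H w)(σ) = q_σ · w(σ)` for some real `q_σ ∈ [a, b]` (the LOCAL ENERGIES of the trial vector). Then

  `a ≤ E(W) ≤ b`,  `E(W) = lowestEnergyInSector n H (|Λ|n/2 − W)`;

and for the central sector `2W = |Λ| n` the same bracket holds for the ground-state energy `E₀(H)`
(`groundEnergy_mem_Icc_of_marshall_positive_trial`, by the tree's `LiebMattis.lowestEnergyInSector_central_eq_groundEnergy`).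

## Proof

By the Marshall–Lieb–Mattis theorem (the tree's `LiebMattis.sector_perronFrobenius`) the sector ground state `ψ`,
`Hψ = E(W)ψ`, satisfies `c (−1)^{Σ_A σ} ψ(σ) > 0` for a constant `c ≠ 0`. As in part 1, termwise
`conj(ψ(σ)) w(σ) conj(c) = (c m_σ ψ(σ)) (m_σ w(σ)) =: r_σ > 0` (`m_σ = ±1` the Marshall sign). Hence
`⟨ψ, w⟩ conj(c) = Σ_σ r_σ =: R > 0` and, `H` being Hermitian with the real eigenvalue `E(W)` at `ψ`,
`⟨ψ, Hw⟩ conj(c) = E(W) R`; on the other hand `⟨ψ, Hw⟩ conj(c) = Σ_σ q_σ r_σ ∈ [aR, bR]`. Divide by `R`.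
This is the finite-dimensional Collatz–Wielandt inequality `min_i (Mu)_i/u_i ≤ ρ(M) ≤ max_i (Mu)_i/u_i`
(nonnegative irreducible `M = const − H'`, `u > 0`; Horn–Johnson, *Matrix Analysis* (2013) Cor. 8.1.29 /
Thm 8.3.4) read for the gauged Hamiltonian; Marshall (1955); Lieb–Mattis (1962) Thm 2; Tasaki (2020) Thm 2.3.

References: [Marshall1955], [LiebMattis1962], [Tasaki2020], [HornJohnson2013]. Typer `pub-qchem-typer` (gen 21),
0 core-h.
-/

noncomputable section

namespace Summit.Ventures.CertifiedQuantumChemistry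

open Matrix Finset
open Literature.MathematicalPhysics.QuantumLattice

section CollatzWielandt

variable {Λ : Type*} [Fintype Λ] [DecidableEq Λ] (n : ℕ) (G : SimpleGraph Λ) [DecidableRel G.Adj] (J : ℝ)

/-- **Collatz–Wielandt enclosure of a sector energy from a strictly Marshall-positive trial vector.** For the
antiferromagnet `H = J Σ 𝐒_x·𝐒_y` (`J > 0`) on a connected graph bipartite in `A`, `Aᶜ`, a nonempty weight sector
`W`, a vector `w` supported in the sector with `(−1)^{Σ_A σ} w(σ) > 0` on every configuration of weight `W`, and
local energies `(Hw)(σ) = q_σ w(σ)`, `q_σ ∈ [a, b]`, on those configurations: `a ≤ E(W) ≤ b`. -/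
theorem lowestEnergyInSector_mem_Icc_of_marshall_positive_trial (A : Finset Λ) (hG : G.Connected)
    (hA : G.IsBipartiteWith (A : Set Λ) (↑A)ᶜ) (hJ : 0 < J) (W : ℕ)
    (hW : ∃ σ : TensorIndex Λ (n + 1), (∑ z, (σ z : ℕ)) = W)
    {w : TensorIndex Λ (n + 1) → ℂ}
    (hw : w ∈ spinZSector (Λ := Λ) n (((Fintype.card Λ * n : ℕ) : ℝ) / 2 - W))
    (hpos : ∀ σ : TensorIndex Λ (n + 1), (∑ z, (σ z : ℕ)) = W →
      0 < (marshallSign A σ * w σ).re ∧ (marshallSign A σ * w σ).im = 0)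
    {a b : ℝ}
    (hq : ∀ σ : TensorIndex Λ (n + 1), (∑ z, (σ z : ℕ)) = W →
      ∃ q : ℝ, a ≤ q ∧ q ≤ b ∧ (heisenbergHamiltonian n G J *ᵥ w) σ = (q : ℂ) * w σ) :
    a ≤ lowestEnergyInSector n (heisenbergHamiltonian n G J) (((Fintype.card Λ * n : ℕ) : ℝ) / 2 - W) ∧
      lowestEnergyInSector n (heisenbergHamiltonian n G J) (((Fintype.card Λ * n : ℕ) : ℝ) / 2 - W) ≤ b := by
  set H := heisenbergHamiltonian n G J with hHdef
  set E := lowestEnergyInSector n H (((Fintype.card Λ * n : ℕ) : ℝ) / 2 - W) with hEdef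
  obtain ⟨⟨ψ, hψK, hψ0, hHψ⟩, -, -, hsign⟩ := LiebMattis.sector_perronFrobenius n G J A hG hA hJ W hW
  obtain ⟨c, hc0, hcpos⟩ := hsign ψ hψK hHψ hψ0
  have hw0 : ∀ σ : TensorIndex Λ (n + 1), (∑ z, (σ z : ℕ)) ≠ W → w σ = 0 :=
    (LiebMattis.mem_spinZSector_weight_iff n W w).1 hw
  -- the local energies as a function
  choose! q hqa hqb hqw using hq
  -- termwise identity `conj(ψ σ) w σ conj c = (c m ψσ)(m wσ)`
  have hterm : ∀ σ : TensorIndex Λ (n + 1), star (ψ σ) * w σ * star c =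
      (c * marshallSign A σ * ψ σ) * (marshallSign A σ * w σ) := by
    intro σ
    by_cases hσ : (∑ z, (σ z : ℕ)) = W
    · have hreal : star (c * marshallSign A σ * ψ σ) = c * marshallSign A σ * ψ σ :=
        Complex.conj_eq_iff_im.2 (hcpos σ hσ).2
      have hmm := LiebMattis.marshallSign_mul_self A σ
      have hcψ : star (c * ψ σ) = c * ψ σ := by
        rw [star_mul', star_mul', LiebMattis.star_marshallSign] at hreal
        calc star (c * ψ σ) = star c * star (ψ σ) * (marshallSign A σ * marshallSign A σ) := by
              rw [hmm, mul_one, star_mul']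
          _ = star c * marshallSign A σ * star (ψ σ) * marshallSign A σ := by ring
          _ = c * marshallSign A σ * ψ σ * marshallSign A σ := by rw [hreal]
          _ = c * ψ σ := by rw [mul_assoc, mul_comm (ψ σ), ← mul_assoc, mul_assoc c, hmm, mul_one]
      rw [star_mul'] at hcψ
      calc star (ψ σ) * w σ * star c = star c * star (ψ σ) * w σ := by ring
        _ = c * ψ σ * w σ := by rw [hcψ]
        _ = c * marshallSign A σ * ψ σ * (marshallSign A σ * w σ) := by
            rw [show c * marshallSign A σ * ψ σ * (marshallSign A σ * w σ) =
              c * ψ σ * w σ * (marshallSign A σ * marshallSign A σ) by ring, hmm, mul_one]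
    · rw [hw0 σ hσ, mul_zero, zero_mul, mul_zero, mul_zero]
  -- the positive reals `r σ`
  set r : TensorIndex Λ (n + 1) → ℝ := fun σ => ((c * marshallSign A σ * ψ σ) * (marshallSign A σ * w σ)).re
    with hrdef
  have hr_eq : ∀ σ, (c * marshallSign A σ * ψ σ) * (marshallSign A σ * w σ) = (r σ : ℂ) := by
    intro σ
    apply Complex.ext
    · rw [Complex.ofReal_re]
    · rw [Complex.ofReal_im]
      by_cases hσ : (∑ z, (σ z : ℕ)) = W
      · rw [Complex.mul_im, (hcpos σ hσ).2, (hpos σ hσ).2, mul_zero, zero_mul, add_zero]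
      · rw [hw0 σ hσ, mul_zero, mul_zero, Complex.zero_im]
  have hr_nonneg : ∀ σ, 0 ≤ r σ := by
    intro σ
    by_cases hσ : (∑ z, (σ z : ℕ)) = W
    · show 0 ≤ ((c * marshallSign A σ * ψ σ) * (marshallSign A σ * w σ)).re
      rw [Complex.mul_re, (hcpos σ hσ).2, zero_mul, sub_zero]
      exact mul_nonneg (hcpos σ hσ).1.le (hpos σ hσ).1.le
    · show 0 ≤ ((c * marshallSign A σ * ψ σ) * (marshallSign A σ * w σ)).re
      rw [hw0 σ hσ, mul_zero, mul_zero, Complex.zero_re]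
  have hr_zero : ∀ σ, (∑ z, (σ z : ℕ)) ≠ W → r σ = 0 := by
    intro σ hσ
    show ((c * marshallSign A σ * ψ σ) * (marshallSign A σ * w σ)).re = 0
    rw [hw0 σ hσ, mul_zero, mul_zero, Complex.zero_re]
  set R : ℝ := ∑ σ, r σ with hRdef
  have hRpos : 0 < R := by
    obtain ⟨σ₀, hσ₀⟩ := hW
    have hlt : 0 < r σ₀ := by
      show 0 < ((c * marshallSign A σ₀ * ψ σ₀) * (marshallSign A σ₀ * w σ₀)).re
      rw [Complex.mul_re, (hcpos σ₀ hσ₀).2, zero_mul, sub_zero]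
      exact mul_pos (hcpos σ₀ hσ₀).1 (hpos σ₀ hσ₀).1
    exact lt_of_lt_of_le hlt (Finset.single_le_sum (fun σ _ => hr_nonneg σ) (Finset.mem_univ σ₀))
  -- `⟨ψ, w⟩ conj c = R`
  have hS : (star ψ ⬝ᵥ w) * star c = (R : ℂ) := by
    rw [dotProduct, Finset.sum_mul, hRdef, Complex.ofReal_sum]
    exact Finset.sum_congr rfl fun σ _ => by rw [Pi.star_apply, hterm σ, hr_eq σ]
  -- `⟨ψ, Hw⟩ conj c = E R` (Hermitian, real eigenvalue)
  have hHerm : H.IsHermitian := heisenbergHamiltonian_isHermitian n G J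
  have hvec : star ψ ᵥ* H = (E : ℂ) • star ψ := by
    have h := Matrix.star_mulVec H ψ
    rw [hHerm.eq, hHψ, star_smul, Complex.star_def, Complex.conj_ofReal] at h
    exact h.symm
  have hE1 : (star ψ ⬝ᵥ (H *ᵥ w)) * star c = (E : ℂ) * (R : ℂ) := by
    rw [Matrix.dotProduct_mulVec, hvec, smul_dotProduct, smul_eq_mul, mul_assoc, hS]
  -- `⟨ψ, Hw⟩ conj c = Σ q_σ r_σ`
  have hE2 : (star ψ ⬝ᵥ (H *ᵥ w)) * star c = ((∑ σ, q σ * r σ : ℝ) : ℂ) := by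
    rw [dotProduct, Finset.sum_mul, Complex.ofReal_sum]
    refine Finset.sum_congr rfl fun σ _ => ?_
    by_cases hσ : (∑ z, (σ z : ℕ)) = W
    · rw [Pi.star_apply, hqw σ hσ, show star (ψ σ) * ((q σ : ℂ) * w σ) * star c =
        (q σ : ℂ) * (star (ψ σ) * w σ * star c) by ring, hterm σ, hr_eq σ]
      push_cast
      ring
    · have hHw : (H *ᵥ w) σ = 0 :=
        LiebMattis.mulVec_supported_of_commute_totalSpin_two n (commute_heisenbergHamiltonian_totalSpin n G J 2)
          (W := W) hw0 σ hσ
      rw [Pi.star_apply, hHw, hr_zero σ hσ]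
      push_cast
      ring
  have hkey : E * R = ∑ σ, q σ * r σ := by exact_mod_cast hE1.symm.trans hE2
  -- bounds `a R ≤ Σ q r ≤ b R`
  have hlow : a * R ≤ ∑ σ, q σ * r σ := by
    rw [hRdef, Finset.mul_sum]
    refine Finset.sum_le_sum fun σ _ => ?_
    by_cases hσ : (∑ z, (σ z : ℕ)) = W
    · exact mul_le_mul_of_nonneg_right (hqa σ hσ) (hr_nonneg σ)
    · rw [hr_zero σ hσ, mul_zero, mul_zero]
  have hupp : ∑ σ, q σ * r σ ≤ b * R := by
    rw [hRdef, Finset.mul_sum]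
    refine Finset.sum_le_sum fun σ _ => ?_
    by_cases hσ : (∑ z, (σ z : ℕ)) = W
    · exact mul_le_mul_of_nonneg_right (hqb σ hσ) (hr_nonneg σ)
    · rw [hr_zero σ hσ, mul_zero, mul_zero]
  rw [← hkey] at hlow hupp
  exact ⟨le_of_mul_le_mul_right hlow hRpos, le_of_mul_le_mul_right hupp hRpos⟩

/-- **Collatz–Wielandt enclosure of the ground-state energy** (balanced case `2W = |Λ| n`, where the central sector
carries `E₀` by the tree's `LiebMattis.lowestEnergyInSector_central_eq_groundEnergy`): under the hypotheses of
`lowestEnergyInSector_mem_Icc_of_marshall_positive_trial`, `a ≤ E₀(H) ≤ b`. -/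
theorem groundEnergy_mem_Icc_of_marshall_positive_trial (A : Finset Λ) (hG : G.Connected)
    (hA : G.IsBipartiteWith (A : Set Λ) (↑A)ᶜ) (hJ : 0 < J) (W : ℕ) (hc : 2 * W = Fintype.card Λ * n)
    (hW : ∃ σ : TensorIndex Λ (n + 1), (∑ z, (σ z : ℕ)) = W)
    {w : TensorIndex Λ (n + 1) → ℂ}
    (hw : w ∈ spinZSector (Λ := Λ) n (((Fintype.card Λ * n : ℕ) : ℝ) / 2 - W))
    (hpos : ∀ σ : TensorIndex Λ (n + 1), (∑ z, (σ z : ℕ)) = W →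
      0 < (marshallSign A σ * w σ).re ∧ (marshallSign A σ * w σ).im = 0)
    {a b : ℝ}
    (hq : ∀ σ : TensorIndex Λ (n + 1), (∑ z, (σ z : ℕ)) = W →
      ∃ q : ℝ, a ≤ q ∧ q ≤ b ∧ (heisenbergHamiltonian n G J *ᵥ w) σ = (q : ℂ) * w σ) :
    a ≤ (heisenbergHamiltonian n G J).groundEnergy ∧ (heisenbergHamiltonian n G J).groundEnergy ≤ b := by
  rw [← LiebMattis.lowestEnergyInSector_central_eq_groundEnergy n G J W hc]
  exact lowestEnergyInSector_mem_Icc_of_marshall_positive_trial n G J A hG hA hJ W hW hw hpos hq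

end CollatzWielandt

end Summit.Ventures.CertifiedQuantumChemistry

end
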